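import Summits.BirchSwinnertonDyer.BirchSwinnertonDyer.Theorems.Rank1ResidualJetCarrierLevelLiterature
import Summits.BirchSwinnertonDyer.Rank1Residual.JET.CarrierReadingRecordsKitThree
import HarnessLib

/-!
# T1 JET (cell `bsd-jet`), road «R-IDX» record kit at `p = 3` ⟸ NAMED PRINT ONLY: the doors
# `bsdp_of_jetRow{A3,A3_tamX,B3}_tam_min` (multiplicative at `3`) and `bsdp_of_jetRow{A3F,A3F_tamX}_tam_min`
# (tower by a Frobenius witness mod `9`) with the reading binder (K1 ∕ K3), the Kolyvagin–McCallum structure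
# fact, Shimura reciprocity, Darmon 3.6 and Carayol all FED

HONEST FRAMING (programme `BSD-LIT2PART-PROGRAMME-v1.md` §HONESTY, verbatim): «no tranche here proves BSD;
ARM L moves the LITERAL column of an r ≤ 1 census into the kernel-proved-modulo-named-print column; ARM P
changes what «named print» is worth.» THEOREMS ONLY (seat `bsd-jet-pv-1`, session g9;
`--supports stmt-BirchSwinnertonDyer-14418`, helper); nothing is booked by this file; 0 classes move; per
pair, no class statement; whether a row books is referee A's word.

WHAT. The `p = 3` sibling of `Rank1ResidualJetRecordsKitLiterature`: ty's five `p = 3` record doors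
(`JET/CarrierReadingRecordsKit` §2–§3, `…KitThree`) re-issued with `hJ` fed by road K's END FORMS, `hMcU`
replaced by the divided descent (pv-1 g9), `hrec` ∕ `hD36` by the Literature theorems and `hlev` by modularity,
over `JET.bsdp_of_carrier{Ne,Mult}Certificate_level…_of_literature` (`Rank1ResidualJetCarrierLevelLiterature`);
bodies = the kit's, byte for byte, up to the final call. Displayed named print of a `p = 3` JET record after
this file: {`h52` [McC] Prop. 5.2, `hPT` Poitou–Tate for Selmer structures (∀ K), `hF1` [GZ86 III (3.1)],
`h372` Gross Prop. 3.7 (2), `hGZK`, `hKo` Kolyvagin, `hmod` modularity}. References: [cite: Jetchev2008,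
Thm. 1.4, Cor. 1.5 (p. 812)] [cite: Serre1972, §2.4 Prop. 15, §5.2 (iii)] [cite: SilvermanATAEC1994, IV.9.4]
[cite: Wuthrich2014, Lemma 20 (p. 399)] [cite: McCallumLMS1991, Prop. 5.2, Cor. 5.6] [cite: Miller2011LMS, Def. 1.1]
[cite: DiamondShurman2005, Thm. 8.8.1]. Design: no definitions. Axioms: `propext`, `Classical.choice`, `Quot.sound`.
-/

set_option autoImplicit false

noncomputable section

open scoped Classical

open WeierstrassCurve Literature.NumberTheory.EllipticCurves
  Literature.NumberTheory.EllipticCurves.ModularForms Literature.NumberTheory.GaloisCohomology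
  Literature.NumberTheory.EllipticCurves.Rank1Residual
  Literature.NumberTheory.EllipticCurves.Rank1Residual.Typed
  Literature.NumberTheory.EllipticCurves.Rank1Residual.X11RankOneCertificates
  Summit.BirchSwinnertonDyer.BirchSwinnertonDyer.Rank1Residual
  Summit.BirchSwinnertonDyer.BirchSwinnertonDyer.Rank1Residual.IntModel
  Summit.BirchSwinnertonDyer.BirchSwinnertonDyer.Rank1Residual.X11RankOne
  Summit.BirchSwinnertonDyer.BirchSwinnertonDyer.Rank2Observatory.Tam
  Summit.BirchSwinnertonDyer.Rank1Residual Summit.BirchSwinnertonDyer.Rank1Residual.X11b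

namespace Summit.BirchSwinnertonDyer.Rank1Residual.JET

/-- **Bucket A, `p = 3 ∥ N` (MULTIPLICATIVE at `3`), carrier `q ≠ 3`: `BSD(E,3)` for a literal integer model from the two-engine HEEGNER-INDEX line through
named print only** — `bsdp_of_jetRowA3_tam_min` with {`hJ`, `hMcU`, `hrec`, `hD36`, `hlev`} fed (module docstring); certificate
inputs VERBATIM. Displayed: {`h52`, `hPT` ∀K, `hF1`, `h372`, `hGZK`, `hKo`, `hmod`}.
[cite: Jetchev2008, Cor. 1.5 (p. 812)] [cite: Serre1972, §2.4 Prop. 15] [cite: SilvermanATAEC1994, IV.9.4]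
[cite: Miller2011LMS, Def. 1.1] -/
theorem bsdp_of_jetRowA3_tam_min_literature (a1 a2 a3 a4 a6 : ℤ)
    (hmin : (⟨a1, a2, a3, a4, a6⟩ : WeierstrassCurve ℚ).IsGloballyMinimal)
    (h3Δ : (3 : ℤ) ∣ (⟨a1, a2, a3, a4, a6⟩ : WeierstrassCurve ℤ).Δ)
    (h3c₄ : ¬ (3 : ℤ) ∣ (⟨a1, a2, a3, a4, a6⟩ : WeierstrassCurve ℤ).c₄)
    (ℓ₁ ℓ₂ : ℕ) (hℓ₁ : ℓ₁.Prime) (hℓ₂ : ℓ₂.Prime) (h2₁ : ℓ₁ ≠ 2) (h2₂ : ℓ₂ ≠ 2)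
    (h3₁ : ℓ₁ ≠ 3) (h3₂ : ℓ₂ ≠ 3)
    (hΔ₁ : ¬ (ℓ₁ : ℤ) ∣ discOf [a1, a2, a3, a4, a6]) (hΔ₂ : ¬ (ℓ₂ : ℤ) ∣ discOf [a1, a2, a3, a4, a6])
    {n₁ n₂ : ℕ} (hc₁ : countPoints [a1, a2, a3, a4, a6] ℓ₁ = n₁)
    (hc₂ : countPoints [a1, a2, a3, a4, a6] ℓ₂ = n₂)
    (hirr : ∀ t : ZMod 3, t ^ 2 - (((ℓ₁ : ℤ) + 1 - n₁ : ℤ) : ZMod 3) * t + ℓ₁ ≠ 0)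
    (hdet₂ : (ℓ₂ : ZMod 3) = 1) (htr₂ : (((ℓ₂ : ℤ) + 1 - n₂ : ℤ) : ZMod 3) = 2) (hsq : ¬ 9 ∣ n₂)
    (q : ℕ) (T : TamLocal) (hTq : T.p = q) (hT : T.check ⟨a1, a2, a3, a4, a6⟩ = true)
    {c : ℕ} (hvals : T.vals = [c]) {w : ℕ} (hw : w ≤ padicValNat 3 c) (hq3 : q ≠ 3)
    (h52 : McCallum1991.prop52_exists_conductor_kolyvaginClass_order_eq)
    (hPT : ∀ (K : Type) [Field K] [NumberField K], poitouTate_selmerStructure_duality_conj K)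
    (hF1 : Gross1991_heegnerPoint_sub_ratTorsion_mem_E0)
    (h372 : GrossLMS1991.prop37_2_frobeniusCongruence)
    (hGZK : rank_eq_analyticRank_of_analyticRank_le_one)
    (hKo : ∀ (N : ℕ) [NeZero N] (W : WeierstrassCurve ℚ) (K : Type) [Field K] [NumberField K], kolyvagin N W K)
    (hmod : exists_isNewformOf)
    (W : WeierstrassCurve ℚ) (hW : W = ⟨a1, a2, a3, a4, a6⟩)
    {N : ℕ} [NeZero N] {K : Type} [Field K] [NumberField K] (hK : IsImaginaryQuadratic K)
    (hD3 : NumberField.discr K ≠ -3) (hD4 : NumberField.discr K ≠ -4)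
    (hH : SatisfiesHeegnerHypothesis N K) {P : (W.baseChange K).toAffine.Point}
    (hP : IsHeegnerPoint N W K P) (hnt : ¬ IsOfFinAddOrder P) (hqN : q ∣ N)
    (hv : padicValNat 3 (AddSubgroup.zmultiples P).index ≤ w)
    (hr : W.analyticRank ≤ 1) {s : ℚ} (hs : shaAn W = (s : ℂ)) (hvs : padicValRat 3 s = 0) :
    BSDp W 3 := by
  subst hW
  have h0 : discOf [a1, a2, a3, a4, a6] ≠ 0 := fun h ↦ hΔ₁ (by rw [h]; exact dvd_zero _)
  haveI hE : (⟨a1, a2, a3, a4, a6⟩ : WeierstrassCurve ℚ).IsElliptic :=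
    X11b.isElliptic_of_discOf_ne_zero a1 a2 a3 a4 a6 h0
  haveI := hmin
  haveI : Fact (Nat.Prime 3) := ⟨by norm_num⟩
  haveI : Fact (Nat.Prime q) := ⟨hTq ▸ (TamLocal.check_common hT).1⟩
  have hI0 : integralModelInt (⟨a1, a2, a3, a4, a6⟩ : WeierstrassCurve ℚ) = ⟨a1, a2, a3, a4, a6⟩ :=
    integralModelInt_eq_of_map_eq _ (map_mk_int a1 a2 a3 a4 a6)
  -- `ρ̄_{E,3}` onto from the two Frobenius witnesses (irreducible + order 3)
  have hρ : Surj (⟨a1, a2, a3, a4, a6⟩ : WeierstrassCurve ℚ) 3 :=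
    Supersingular.surj_three_of_ainvs_of_irr_of_order a1 a2 a3 a4 a6 hmin ℓ₁ ℓ₂ hℓ₁ hℓ₂ h2₁ h2₂ h3₁ h3₂
      hΔ₁ hΔ₂ hc₁ hc₂ hirr hdet₂ htr₂ hsq
  -- multiplicative at `3`
  have hmult : (⟨a1, a2, a3, a4, a6⟩ : WeierstrassCurve ℚ).HasMultiplicativeReductionAtPrime 3 :=
    hasMultiplicativeReductionAtPrime_of_intModel hI0 3 h3Δ h3c₄
  -- the Tamagawa half in the kernel: `c_q(W/ℚ_q) = c`
  have hcq : ((⟨a1, a2, a3, a4, a6⟩ : WeierstrassCurve ℚ).baseChange ℚ_[q]).localTamagawaNumber ℤ_[q] = c :=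
    Additive.IntModelTam.localTamagawaNumber_padic_eq_of_intModel_of_tamLocal hI0 q hTq hT hvals
  have hI : padicValNat 3 (AddSubgroup.zmultiples P).index ≤ padicValNat 3
      (((⟨a1, a2, a3, a4, a6⟩ : WeierstrassCurve ℚ).baseChange ℚ_[q]).localTamagawaNumber ℤ_[q]) := hcq ▸ hv.trans hw
  exact bsdp_of_carrierNeCertificate_level_of_mult_of_literature h52 hPT hF1 h372 hGZK hKo hmod _ 3 hK hD3 hD4 hH hP hnt
    (by decide) hmult hρ q hqN hq3 hI hr hs hvs

/-- **Bucket A, `p = 3 ∥ N`, carrier `q ≠ 3`, extended `TamLocalX` certificate: `BSD(E,3)` for a literal integer model from the two-engine HEEGNER-INDEX line through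
named print only** — `bsdp_of_jetRowA3_tamX_min` with {`hJ`, `hMcU`, `hrec`, `hD36`, `hlev`} fed (module docstring); certificate
inputs VERBATIM. Displayed: {`h52`, `hPT` ∀K, `hF1`, `h372`, `hGZK`, `hKo`, `hmod`}.
[cite: Jetchev2008, Cor. 1.5 (p. 812)] [cite: Serre1972, §2.4 Prop. 15] [cite: SilvermanATAEC1994, IV.9.4]
[cite: Miller2011LMS, Def. 1.1] -/
theorem bsdp_of_jetRowA3_tamX_min_literature (a1 a2 a3 a4 a6 : ℤ)
    (hmin : (⟨a1, a2, a3, a4, a6⟩ : WeierstrassCurve ℚ).IsGloballyMinimal)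
    (h3Δ : (3 : ℤ) ∣ (⟨a1, a2, a3, a4, a6⟩ : WeierstrassCurve ℤ).Δ)
    (h3c₄ : ¬ (3 : ℤ) ∣ (⟨a1, a2, a3, a4, a6⟩ : WeierstrassCurve ℤ).c₄)
    (ℓ₁ ℓ₂ : ℕ) (hℓ₁ : ℓ₁.Prime) (hℓ₂ : ℓ₂.Prime) (h2₁ : ℓ₁ ≠ 2) (h2₂ : ℓ₂ ≠ 2)
    (h3₁ : ℓ₁ ≠ 3) (h3₂ : ℓ₂ ≠ 3)
    (hΔ₁ : ¬ (ℓ₁ : ℤ) ∣ discOf [a1, a2, a3, a4, a6]) (hΔ₂ : ¬ (ℓ₂ : ℤ) ∣ discOf [a1, a2, a3, a4, a6])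
    {n₁ n₂ : ℕ} (hc₁ : countPoints [a1, a2, a3, a4, a6] ℓ₁ = n₁)
    (hc₂ : countPoints [a1, a2, a3, a4, a6] ℓ₂ = n₂)
    (hirr : ∀ t : ZMod 3, t ^ 2 - (((ℓ₁ : ℤ) + 1 - n₁ : ℤ) : ZMod 3) * t + ℓ₁ ≠ 0)
    (hdet₂ : (ℓ₂ : ZMod 3) = 1) (htr₂ : (((ℓ₂ : ℤ) + 1 - n₂ : ℤ) : ZMod 3) = 2) (hsq : ¬ 9 ∣ n₂)
    (q : ℕ) (hq : q.Prime) (F : TamX) (hFq : F.p = q) (hF : F.check ⟨a1, a2, a3, a4, a6⟩ = true)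
    {w : ℕ} (hw : w ≤ padicValNat 3 F.c) (hq3 : q ≠ 3)
    (h52 : McCallum1991.prop52_exists_conductor_kolyvaginClass_order_eq)
    (hPT : ∀ (K : Type) [Field K] [NumberField K], poitouTate_selmerStructure_duality_conj K)
    (hF1 : Gross1991_heegnerPoint_sub_ratTorsion_mem_E0)
    (h372 : GrossLMS1991.prop37_2_frobeniusCongruence)
    (hGZK : rank_eq_analyticRank_of_analyticRank_le_one)
    (hKo : ∀ (N : ℕ) [NeZero N] (W : WeierstrassCurve ℚ) (K : Type) [Field K] [NumberField K], kolyvagin N W K)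
    (hmod : exists_isNewformOf)
    (W : WeierstrassCurve ℚ) (hW : W = ⟨a1, a2, a3, a4, a6⟩)
    {N : ℕ} [NeZero N] {K : Type} [Field K] [NumberField K] (hK : IsImaginaryQuadratic K)
    (hD3 : NumberField.discr K ≠ -3) (hD4 : NumberField.discr K ≠ -4)
    (hH : SatisfiesHeegnerHypothesis N K) {P : (W.baseChange K).toAffine.Point}
    (hP : IsHeegnerPoint N W K P) (hnt : ¬ IsOfFinAddOrder P) (hqN : q ∣ N)
    (hv : padicValNat 3 (AddSubgroup.zmultiples P).index ≤ w)
    (hr : W.analyticRank ≤ 1) {s : ℚ} (hs : shaAn W = (s : ℂ)) (hvs : padicValRat 3 s = 0) :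
    BSDp W 3 := by
  subst hW
  have h0 : discOf [a1, a2, a3, a4, a6] ≠ 0 := fun h ↦ hΔ₁ (by rw [h]; exact dvd_zero _)
  haveI hE : (⟨a1, a2, a3, a4, a6⟩ : WeierstrassCurve ℚ).IsElliptic :=
    X11b.isElliptic_of_discOf_ne_zero a1 a2 a3 a4 a6 h0
  haveI := hmin
  haveI : Fact (Nat.Prime 3) := ⟨by norm_num⟩
  haveI : Fact (Nat.Prime q) := ⟨hq⟩
  have hI0 : integralModelInt (⟨a1, a2, a3, a4, a6⟩ : WeierstrassCurve ℚ) = ⟨a1, a2, a3, a4, a6⟩ :=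
    integralModelInt_eq_of_map_eq _ (map_mk_int a1 a2 a3 a4 a6)
  have hρ : Surj (⟨a1, a2, a3, a4, a6⟩ : WeierstrassCurve ℚ) 3 :=
    Supersingular.surj_three_of_ainvs_of_irr_of_order a1 a2 a3 a4 a6 hmin ℓ₁ ℓ₂ hℓ₁ hℓ₂ h2₁ h2₂ h3₁ h3₂
      hΔ₁ hΔ₂ hc₁ hc₂ hirr hdet₂ htr₂ hsq
  have hmult : (⟨a1, a2, a3, a4, a6⟩ : WeierstrassCurve ℚ).HasMultiplicativeReductionAtPrime 3 :=
    hasMultiplicativeReductionAtPrime_of_intModel hI0 3 h3Δ h3c₄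
  -- the Tamagawa half in the kernel: `c_q(W/ℚ_q) = F.c` (exact IV / IV* certificate)
  have hcq : ((⟨a1, a2, a3, a4, a6⟩ : WeierstrassCurve ℚ).baseChange ℚ_[q]).localTamagawaNumber ℤ_[q] = F.c :=
    Additive.IntModelTam.localTamagawaNumber_padic_eq_of_intModel_of_tamX hI0 q hFq hF
  have hI : padicValNat 3 (AddSubgroup.zmultiples P).index ≤ padicValNat 3
      (((⟨a1, a2, a3, a4, a6⟩ : WeierstrassCurve ℚ).baseChange ℚ_[q]).localTamagawaNumber ℤ_[q]) := hcq ▸ hv.trans hw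
  exact bsdp_of_carrierNeCertificate_level_of_mult_of_literature h52 hPT hF1 h372 hGZK hKo hmod _ 3 hK hD3 hD4 hH hP hnt
    (by decide) hmult hρ q hqN hq3 hI hr hs hvs

/-- **Bucket B, `p = 3` (carrier `q = 3` split multiplicative): `BSD(E,3)` for a literal integer model from the two-engine HEEGNER-INDEX line through
named print only** — `bsdp_of_jetRowB3_tam_min` with {`hJ`, `hMcU`, `hrec`, `hD36`, `hlev`} fed (module docstring); certificate
inputs VERBATIM. Displayed: {`h52`, `hPT` ∀K, `hF1`, `h372`, `hGZK`, `hKo`, `hmod`}.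
[cite: Jetchev2008, Cor. 1.5 (p. 812)] [cite: Serre1972, §2.4 Prop. 15] [cite: SilvermanATAEC1994, IV.9.4]
[cite: Miller2011LMS, Def. 1.1] -/
theorem bsdp_of_jetRowB3_tam_min_literature (a1 a2 a3 a4 a6 : ℤ)
    (hmin : (⟨a1, a2, a3, a4, a6⟩ : WeierstrassCurve ℚ).IsGloballyMinimal)
    (h3Δ : (3 : ℤ) ∣ (⟨a1, a2, a3, a4, a6⟩ : WeierstrassCurve ℤ).Δ)
    (h3c₄ : ¬ (3 : ℤ) ∣ (⟨a1, a2, a3, a4, a6⟩ : WeierstrassCurve ℤ).c₄)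
    (ℓ₁ ℓ₂ : ℕ) (hℓ₁ : ℓ₁.Prime) (hℓ₂ : ℓ₂.Prime) (h2₁ : ℓ₁ ≠ 2) (h2₂ : ℓ₂ ≠ 2)
    (h3₁ : ℓ₁ ≠ 3) (h3₂ : ℓ₂ ≠ 3)
    (hΔ₁ : ¬ (ℓ₁ : ℤ) ∣ discOf [a1, a2, a3, a4, a6]) (hΔ₂ : ¬ (ℓ₂ : ℤ) ∣ discOf [a1, a2, a3, a4, a6])
    {n₁ n₂ : ℕ} (hc₁ : countPoints [a1, a2, a3, a4, a6] ℓ₁ = n₁)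
    (hc₂ : countPoints [a1, a2, a3, a4, a6] ℓ₂ = n₂)
    (hirr : ∀ t : ZMod 3, t ^ 2 - (((ℓ₁ : ℤ) + 1 - n₁ : ℤ) : ZMod 3) * t + ℓ₁ ≠ 0)
    (hdet₂ : (ℓ₂ : ZMod 3) = 1) (htr₂ : (((ℓ₂ : ℤ) + 1 - n₂ : ℤ) : ZMod 3) = 2) (hsq : ¬ 9 ∣ n₂)
    (T : TamLocal) (hT3 : T.p = 3) (hT : T.check ⟨a1, a2, a3, a4, a6⟩ = true)
    {c : ℕ} (hvals : T.vals = [c]) {w : ℕ} (hw : w ≤ padicValNat 3 c)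
    (h52 : McCallum1991.prop52_exists_conductor_kolyvaginClass_order_eq)
    (hPT : ∀ (K : Type) [Field K] [NumberField K], poitouTate_selmerStructure_duality_conj K)
    (hF1 : Gross1991_heegnerPoint_sub_ratTorsion_mem_E0)
    (h372 : GrossLMS1991.prop37_2_frobeniusCongruence)
    (hGZK : rank_eq_analyticRank_of_analyticRank_le_one)
    (hKo : ∀ (N : ℕ) [NeZero N] (W : WeierstrassCurve ℚ) (K : Type) [Field K] [NumberField K], kolyvagin N W K)
    (hmod : exists_isNewformOf)
    (W : WeierstrassCurve ℚ) (hW : W = ⟨a1, a2, a3, a4, a6⟩)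
    {N : ℕ} [NeZero N] {K : Type} [Field K] [NumberField K] (hK : IsImaginaryQuadratic K)
    (hD3 : NumberField.discr K ≠ -3) (hD4 : NumberField.discr K ≠ -4)
    (hH : SatisfiesHeegnerHypothesis N K) {P : (W.baseChange K).toAffine.Point}
    (hP : IsHeegnerPoint N W K P) (hnt : ¬ IsOfFinAddOrder P)
    (hv : padicValNat 3 (AddSubgroup.zmultiples P).index ≤ w)
    (hr : W.analyticRank ≤ 1) {s : ℚ} (hs : shaAn W = (s : ℂ)) (hvs : padicValRat 3 s = 0) :
    BSDp W 3 := by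
  subst hW
  have h0 : discOf [a1, a2, a3, a4, a6] ≠ 0 := fun h ↦ hΔ₁ (by rw [h]; exact dvd_zero _)
  haveI hE : (⟨a1, a2, a3, a4, a6⟩ : WeierstrassCurve ℚ).IsElliptic :=
    X11b.isElliptic_of_discOf_ne_zero a1 a2 a3 a4 a6 h0
  haveI := hmin
  haveI : Fact (Nat.Prime 3) := ⟨by norm_num⟩
  have hI0 : integralModelInt (⟨a1, a2, a3, a4, a6⟩ : WeierstrassCurve ℚ) = ⟨a1, a2, a3, a4, a6⟩ :=
    integralModelInt_eq_of_map_eq _ (map_mk_int a1 a2 a3 a4 a6)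
  have hρ : Surj (⟨a1, a2, a3, a4, a6⟩ : WeierstrassCurve ℚ) 3 :=
    Supersingular.surj_three_of_ainvs_of_irr_of_order a1 a2 a3 a4 a6 hmin ℓ₁ ℓ₂ hℓ₁ hℓ₂ h2₁ h2₂ h3₁ h3₂
      hΔ₁ hΔ₂ hc₁ hc₂ hirr hdet₂ htr₂ hsq
  have hmult : (⟨a1, a2, a3, a4, a6⟩ : WeierstrassCurve ℚ).HasMultiplicativeReductionAtPrime 3 :=
    hasMultiplicativeReductionAtPrime_of_intModel hI0 3 h3Δ h3c₄
  -- the Tamagawa half in the kernel: `c₃(W/ℚ₃) = c`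
  have hc3 : ((⟨a1, a2, a3, a4, a6⟩ : WeierstrassCurve ℚ).baseChange ℚ_[3]).localTamagawaNumber ℤ_[3] = c :=
    Additive.IntModelTam.localTamagawaNumber_padic_eq_of_intModel_of_tamLocal hI0 3 hT3 hT hvals
  have hI : padicValNat 3 (AddSubgroup.zmultiples P).index ≤ padicValNat 3
      (((⟨a1, a2, a3, a4, a6⟩ : WeierstrassCurve ℚ).baseChange ℚ_[3]).localTamagawaNumber ℤ_[3]) := hc3 ▸ hv.trans hw
  exact bsdp_of_carrierMultCertificate_level_of_surj_of_literature h52 hPT hF1 h372 hGZK hKo hmod _ 3 hK hD3 hD4 hH hP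
    hnt (by decide) hmult hρ hI hr hs hvs

/-- **Bucket A at `p = 3` with the `3`-adic tower by ONE Frobenius witness mod `9` (any reduction at `3`), carrier `q ≠ 3`: `BSD(E,3)` for a literal integer model from the two-engine HEEGNER-INDEX line through
named print only** — `bsdp_of_jetRowA3F_tam_min` with {`hJ`, `hMcU`, `hrec`, `hD36`, `hlev`} fed (module docstring); certificate
inputs VERBATIM. Displayed: {`h52`, `hPT` ∀K, `hF1`, `h372`, `hGZK`, `hKo`, `hmod`}.
[cite: Jetchev2008, Cor. 1.5 (p. 812)] [cite: Serre1972, §2.4 Prop. 15] [cite: SilvermanATAEC1994, IV.9.4]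
[cite: Miller2011LMS, Def. 1.1] -/
theorem bsdp_of_jetRowA3F_tam_min_literature (a1 a2 a3 a4 a6 : ℤ)
    (hmin : (⟨a1, a2, a3, a4, a6⟩ : WeierstrassCurve ℚ).IsGloballyMinimal)
    (ℓ₁ ℓ₂ : ℕ) (hℓ₁ : ℓ₁.Prime) (hℓ₂ : ℓ₂.Prime) (h2₁ : ℓ₁ ≠ 2) (h2₂ : ℓ₂ ≠ 2)
    (h3₁ : ℓ₁ ≠ 3) (h3₂ : ℓ₂ ≠ 3)
    (hΔ₁ : ¬ (ℓ₁ : ℤ) ∣ discOf [a1, a2, a3, a4, a6]) (hΔ₂ : ¬ (ℓ₂ : ℤ) ∣ discOf [a1, a2, a3, a4, a6])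
    {n₁ n₂ : ℕ} (hc₁ : countPoints [a1, a2, a3, a4, a6] ℓ₁ = n₁)
    (hc₂ : countPoints [a1, a2, a3, a4, a6] ℓ₂ = n₂)
    (hirr : ∀ t : ZMod 3, t ^ 2 - (((ℓ₁ : ℤ) + 1 - n₁ : ℤ) : ZMod 3) * t + ℓ₁ ≠ 0)
    (hdet₂ : (ℓ₂ : ZMod 3) = 1) (htr₂ : (((ℓ₂ : ℤ) + 1 - n₂ : ℤ) : ZMod 3) = 2) (hsq : ¬ 9 ∣ n₂)
    (ℓ₉ : ℕ) (hℓ₉ : ℓ₉.Prime) (h2₉ : ℓ₉ ≠ 2)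
    (hΔ₉ : ¬ (ℓ₉ : ℤ) ∣ (⟨a1, a2, a3, a4, a6⟩ : WeierstrassCurve ℤ).Δ)
    {n₉ : ℕ} (hc₉ : countPoints [a1, a2, a3, a4, a6] ℓ₉ = n₉)
    (hℓ9 : ℓ₉ % 9 = 2 ∨ ℓ₉ % 9 = 5)
    (ha9 : ((ℓ₉ : ℤ) + 1 - n₉) % 9 = 3 ∨ ((ℓ₉ : ℤ) + 1 - n₉) % 9 = 6)
    (q : ℕ) (T : TamLocal) (hTq : T.p = q) (hT : T.check ⟨a1, a2, a3, a4, a6⟩ = true)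
    {c : ℕ} (hvals : T.vals = [c]) {w : ℕ} (hw : w ≤ padicValNat 3 c) (hq3 : q ≠ 3)
    (h52 : McCallum1991.prop52_exists_conductor_kolyvaginClass_order_eq)
    (hPT : ∀ (K : Type) [Field K] [NumberField K], poitouTate_selmerStructure_duality_conj K)
    (hF1 : Gross1991_heegnerPoint_sub_ratTorsion_mem_E0)
    (h372 : GrossLMS1991.prop37_2_frobeniusCongruence)
    (hGZK : rank_eq_analyticRank_of_analyticRank_le_one)
    (hKo : ∀ (N : ℕ) [NeZero N] (W : WeierstrassCurve ℚ) (K : Type) [Field K] [NumberField K], kolyvagin N W K)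
    (hmod : exists_isNewformOf)
    (W : WeierstrassCurve ℚ) (hW : W = ⟨a1, a2, a3, a4, a6⟩)
    {N : ℕ} [NeZero N] {K : Type} [Field K] [NumberField K] (hK : IsImaginaryQuadratic K)
    (hD3 : NumberField.discr K ≠ -3) (hD4 : NumberField.discr K ≠ -4)
    (hH : SatisfiesHeegnerHypothesis N K) {P : (W.baseChange K).toAffine.Point}
    (hP : IsHeegnerPoint N W K P) (hnt : ¬ IsOfFinAddOrder P) (hqN : q ∣ N)
    (hv : padicValNat 3 (AddSubgroup.zmultiples P).index ≤ w)
    (hr : W.analyticRank ≤ 1) {s : ℚ} (hs : shaAn W = (s : ℂ)) (hvs : padicValRat 3 s = 0) :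
    BSDp W 3 := by
  subst hW
  have h0 : discOf [a1, a2, a3, a4, a6] ≠ 0 := fun h ↦ hΔ₁ (by rw [h]; exact dvd_zero _)
  haveI hE : (⟨a1, a2, a3, a4, a6⟩ : WeierstrassCurve ℚ).IsElliptic :=
    X11b.isElliptic_of_discOf_ne_zero a1 a2 a3 a4 a6 h0
  haveI := hmin
  haveI : Fact (Nat.Prime 3) := ⟨by norm_num⟩
  haveI : Fact (Nat.Prime q) := ⟨hTq ▸ (TamLocal.check_common hT).1⟩
  haveI := Fact.mk hℓ₉
  have hI0 : integralModelInt (⟨a1, a2, a3, a4, a6⟩ : WeierstrassCurve ℚ) = ⟨a1, a2, a3, a4, a6⟩ :=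
    integralModelInt_eq_of_map_eq _ (map_mk_int a1 a2 a3 a4 a6)
  -- `ρ̄_{E,3}` onto from the two Frobenius witnesses (irreducible + order 3)
  have hρ : Surj (⟨a1, a2, a3, a4, a6⟩ : WeierstrassCurve ℚ) 3 :=
    Supersingular.surj_three_of_ainvs_of_irr_of_order a1 a2 a3 a4 a6 hmin ℓ₁ ℓ₂ hℓ₁ hℓ₂ h2₁ h2₂ h3₁ h3₂
      hΔ₁ hΔ₂ hc₁ hc₂ hirr hdet₂ htr₂ hsq
  -- the `3`-adic tower from the mod-`9` Frobenius witness (Serre IV-23)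
  have hn₉ : Nat.card (((⟨a1, a2, a3, a4, a6⟩ : WeierstrassCurve ℤ).map
      (Int.castRingHom (ZMod ℓ₉))).toAffine.Point) = n₉ := by
    exact_mod_cast (X11b.natCard_point_eq_countPoints a1 a2 a3 a4 a6 ℓ₉ h2₉ hΔ₉).trans hc₉
  have htower : ∀ n : ℕ, (⟨a1, a2, a3, a4, a6⟩ : WeierstrassCurve ℚ).HasSurjectiveModNGaloisRep (3 ^ n : ℕ) :=
    GaloisImage.forall_hasSurjectiveModNGaloisRep_three_pow_of_intModel_of_frobenius hI0 hρ ℓ₉ hΔ₉ hn₉ hℓ9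
      ha9
  -- the Tamagawa half in the kernel: `c_q(W/ℚ_q) = c`
  have hcq : ((⟨a1, a2, a3, a4, a6⟩ : WeierstrassCurve ℚ).baseChange ℚ_[q]).localTamagawaNumber ℤ_[q] = c :=
    Additive.IntModelTam.localTamagawaNumber_padic_eq_of_intModel_of_tamLocal hI0 q hTq hT hvals
  have hI : padicValNat 3 (AddSubgroup.zmultiples P).index ≤ padicValNat 3
      (((⟨a1, a2, a3, a4, a6⟩ : WeierstrassCurve ℚ).baseChange ℚ_[q]).localTamagawaNumber ℤ_[q]) := hcq ▸ hv.trans hw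
  exact bsdp_of_carrierNeCertificate_level_of_literature h52 hPT hF1 h372 hGZK hKo hmod _ 3 hK hD3 hD4 hH hP hnt
    (by decide) htower q hqN hq3 hI hr hs hvs

/-- **the same with the extended `TamLocalX` certificate: `BSD(E,3)` for a literal integer model from the two-engine HEEGNER-INDEX line through
named print only** — `bsdp_of_jetRowA3F_tamX_min` with {`hJ`, `hMcU`, `hrec`, `hD36`, `hlev`} fed (module docstring); certificate
inputs VERBATIM. Displayed: {`h52`, `hPT` ∀K, `hF1`, `h372`, `hGZK`, `hKo`, `hmod`}.
[cite: Jetchev2008, Cor. 1.5 (p. 812)] [cite: Serre1972, §2.4 Prop. 15] [cite: SilvermanATAEC1994, IV.9.4]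
[cite: Miller2011LMS, Def. 1.1] -/
theorem bsdp_of_jetRowA3F_tamX_min_literature (a1 a2 a3 a4 a6 : ℤ)
    (hmin : (⟨a1, a2, a3, a4, a6⟩ : WeierstrassCurve ℚ).IsGloballyMinimal)
    (ℓ₁ ℓ₂ : ℕ) (hℓ₁ : ℓ₁.Prime) (hℓ₂ : ℓ₂.Prime) (h2₁ : ℓ₁ ≠ 2) (h2₂ : ℓ₂ ≠ 2)
    (h3₁ : ℓ₁ ≠ 3) (h3₂ : ℓ₂ ≠ 3)
    (hΔ₁ : ¬ (ℓ₁ : ℤ) ∣ discOf [a1, a2, a3, a4, a6]) (hΔ₂ : ¬ (ℓ₂ : ℤ) ∣ discOf [a1, a2, a3, a4, a6])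
    {n₁ n₂ : ℕ} (hc₁ : countPoints [a1, a2, a3, a4, a6] ℓ₁ = n₁)
    (hc₂ : countPoints [a1, a2, a3, a4, a6] ℓ₂ = n₂)
    (hirr : ∀ t : ZMod 3, t ^ 2 - (((ℓ₁ : ℤ) + 1 - n₁ : ℤ) : ZMod 3) * t + ℓ₁ ≠ 0)
    (hdet₂ : (ℓ₂ : ZMod 3) = 1) (htr₂ : (((ℓ₂ : ℤ) + 1 - n₂ : ℤ) : ZMod 3) = 2) (hsq : ¬ 9 ∣ n₂)
    (ℓ₉ : ℕ) (hℓ₉ : ℓ₉.Prime) (h2₉ : ℓ₉ ≠ 2)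
    (hΔ₉ : ¬ (ℓ₉ : ℤ) ∣ (⟨a1, a2, a3, a4, a6⟩ : WeierstrassCurve ℤ).Δ)
    {n₉ : ℕ} (hc₉ : countPoints [a1, a2, a3, a4, a6] ℓ₉ = n₉)
    (hℓ9 : ℓ₉ % 9 = 2 ∨ ℓ₉ % 9 = 5)
    (ha9 : ((ℓ₉ : ℤ) + 1 - n₉) % 9 = 3 ∨ ((ℓ₉ : ℤ) + 1 - n₉) % 9 = 6)
    (q : ℕ) (hq : q.Prime) (F : TamX) (hFq : F.p = q) (hF : F.check ⟨a1, a2, a3, a4, a6⟩ = true)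
    {w : ℕ} (hw : w ≤ padicValNat 3 F.c) (hq3 : q ≠ 3)
    (h52 : McCallum1991.prop52_exists_conductor_kolyvaginClass_order_eq)
    (hPT : ∀ (K : Type) [Field K] [NumberField K], poitouTate_selmerStructure_duality_conj K)
    (hF1 : Gross1991_heegnerPoint_sub_ratTorsion_mem_E0)
    (h372 : GrossLMS1991.prop37_2_frobeniusCongruence)
    (hGZK : rank_eq_analyticRank_of_analyticRank_le_one)
    (hKo : ∀ (N : ℕ) [NeZero N] (W : WeierstrassCurve ℚ) (K : Type) [Field K] [NumberField K], kolyvagin N W K)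
    (hmod : exists_isNewformOf)
    (W : WeierstrassCurve ℚ) (hW : W = ⟨a1, a2, a3, a4, a6⟩)
    {N : ℕ} [NeZero N] {K : Type} [Field K] [NumberField K] (hK : IsImaginaryQuadratic K)
    (hD3 : NumberField.discr K ≠ -3) (hD4 : NumberField.discr K ≠ -4)
    (hH : SatisfiesHeegnerHypothesis N K) {P : (W.baseChange K).toAffine.Point}
    (hP : IsHeegnerPoint N W K P) (hnt : ¬ IsOfFinAddOrder P) (hqN : q ∣ N)
    (hv : padicValNat 3 (AddSubgroup.zmultiples P).index ≤ w)
    (hr : W.analyticRank ≤ 1) {s : ℚ} (hs : shaAn W = (s : ℂ)) (hvs : padicValRat 3 s = 0) :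
    BSDp W 3 := by
  subst hW
  have h0 : discOf [a1, a2, a3, a4, a6] ≠ 0 := fun h ↦ hΔ₁ (by rw [h]; exact dvd_zero _)
  haveI hE : (⟨a1, a2, a3, a4, a6⟩ : WeierstrassCurve ℚ).IsElliptic :=
    X11b.isElliptic_of_discOf_ne_zero a1 a2 a3 a4 a6 h0
  haveI := hmin
  haveI : Fact (Nat.Prime 3) := ⟨by norm_num⟩
  haveI : Fact (Nat.Prime q) := ⟨hq⟩
  haveI := Fact.mk hℓ₉
  have hI0 : integralModelInt (⟨a1, a2, a3, a4, a6⟩ : WeierstrassCurve ℚ) = ⟨a1, a2, a3, a4, a6⟩ :=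
    integralModelInt_eq_of_map_eq _ (map_mk_int a1 a2 a3 a4 a6)
  have hρ : Surj (⟨a1, a2, a3, a4, a6⟩ : WeierstrassCurve ℚ) 3 :=
    Supersingular.surj_three_of_ainvs_of_irr_of_order a1 a2 a3 a4 a6 hmin ℓ₁ ℓ₂ hℓ₁ hℓ₂ h2₁ h2₂ h3₁ h3₂
      hΔ₁ hΔ₂ hc₁ hc₂ hirr hdet₂ htr₂ hsq
  have hn₉ : Nat.card (((⟨a1, a2, a3, a4, a6⟩ : WeierstrassCurve ℤ).map
      (Int.castRingHom (ZMod ℓ₉))).toAffine.Point) = n₉ := by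
    exact_mod_cast (X11b.natCard_point_eq_countPoints a1 a2 a3 a4 a6 ℓ₉ h2₉ hΔ₉).trans hc₉
  have htower : ∀ n : ℕ, (⟨a1, a2, a3, a4, a6⟩ : WeierstrassCurve ℚ).HasSurjectiveModNGaloisRep (3 ^ n : ℕ) :=
    GaloisImage.forall_hasSurjectiveModNGaloisRep_three_pow_of_intModel_of_frobenius hI0 hρ ℓ₉ hΔ₉ hn₉ hℓ9
      ha9
  -- the Tamagawa half in the kernel: `c_q(W/ℚ_q) = F.c` (exact IV / IV* certificate)
  have hcq : ((⟨a1, a2, a3, a4, a6⟩ : WeierstrassCurve ℚ).baseChange ℚ_[q]).localTamagawaNumber ℤ_[q] = F.c :=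
    Additive.IntModelTam.localTamagawaNumber_padic_eq_of_intModel_of_tamX hI0 q hFq hF
  have hI : padicValNat 3 (AddSubgroup.zmultiples P).index ≤ padicValNat 3
      (((⟨a1, a2, a3, a4, a6⟩ : WeierstrassCurve ℚ).baseChange ℚ_[q]).localTamagawaNumber ℤ_[q]) := hcq ▸ hv.trans hw
  exact bsdp_of_carrierNeCertificate_level_of_literature h52 hPT hF1 h372 hGZK hKo hmod _ 3 hK hD3 hD4 hH hP hnt
    (by decide) htower q hqN hq3 hI hr hs hvs
end Summit.BirchSwinnertonDyer.Rank1Residual.JET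

end
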